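import Summits.BirchSwinnertonDyer.BirchSwinnertonDyer.Theorems.UniversalToricDescentThinCombCore
import Summits.BirchSwinnertonDyer.Rank1Residual.X2.HidaLimitCongruenceAlgebra
import Literature.NumberTheory.IwasawaTheory.IwasawaAlgebraTwoVarRegularProofs
import HarnessLib

/-!
# Thin-comb rigidity (crux idea `thin-comb-reflection` on the WALL `AdditiveSplitIMCInclusionAtThree`, item
# stmt-BirchSwinnertonDyer-20395) — Part IV: the RIGIDITY THEOREM, card item K1 PROVED
# (helper, `--supports stmt-BirchSwinnertonDyer-20395`; cell `pub/bsd-wall`, lead `cruxlead-20395`)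

MAIN RESULTS (for every discrete valuation ring `𝒪` with maximal ideal `(p)`; instances `ℤ_p` and
`R₀ = unrIntegers p = W(𝔽̄_p)`):
* `combReflectionRigidityRat_of_maximalIdeal_eq : CombReflectionRigidityRat 𝒪 p` — if `G, F ∈ 𝒪⟦T₂⟧⟦T₁⟧` are
  `ρ`-symmetric up to units for a reflection `ρ` (`1+T₁ ↦ (1+T₂)⁻¹`, `1+T₂ ↦ (1+T₁)⁻¹`, constants fixed) and
  `G ∣ p^{t_m}·F (mod E_m(T₂))` on comb levels `m` of unbounded order (`E_m = Φ_{p^{m+1}}(1+T₂)`, the `𝒪`-rational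
  equation of the lines `T₂ = ζ_{p^{m+1}} − 1`), then `G ∣ p^a·F` for some `a`;
* `combReflectionRigidityInt_of_maximalIdeal_eq : CombReflectionRigidityInt 𝒪 p` — with INTEGRAL comb
  divisibility, `G ∣ F`.

PROOF (prime by prime over the factorial ring `Λ₂(𝒪)`, tree `uniqueFactorizationMonoid_powerSeries_powerSeries`;
no Weierstrass preparation, no `p`-adic zeros, no roots of unity). Write `G = p^n·G₀` with `p ∤ G₀`; it suffices that
every prime power `P^k ∣ G₀` divides `F` (`UniqueFactorizationMonoid.induction_on_coprime`). TRICHOTOMY by the two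
ideals `(p, T₂)` and `(p, T₁)` of `Λ₂(𝒪)`: (a) `P ∉ (p, T₂)` is VISIBLE on every level (Part II), so Part III
applies; (b) `P ∈ (p, T₂) ∩ (p, T₁)` is visible on all levels `m ≥ m₀(P)` (Part II), so Part III applies;
(c) `P ∈ (p, T₂)`, `P ∉ (p, T₁)`: the reflection maps `(p, T₁)` onto `(p, T₂)` (from `(1+T₂)(1+ρT₁) = 1`:
`ρT₁ = −T₂(1+T₂)⁻¹`), so `ρP ∉ (p, T₂)` is a prime of case (a) dividing `ρG₀ ∼ G₀`; hence `(ρP)^k ∣ F` and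
`P^k ∣ ρ⁻¹F ∼ F`. The `p`-power: lost to the slack in the rational form; detected coefficientwise in the integral
form (Part II `C_pow_dvd_of_mk_mem_span`), and `p^n`, `G₀` are coprime. The case `G = 0` forces `F = 0`.

REMARK (for the planners). Only two consequences of `IsReflection` are used: `ρ` fixes constants and
`ρ(p, T₁) = (p, T₂)`. In particular the lemma holds for ANY `𝒪`-automorphism exchanging the two "bad" ideals —
the arithmetic content of the functional equations (card items K3(iii)/K4) enters only through the HYPOTHESES
`ρ G ∼ G`, `ρ F ∼ F`. What the lemma does NOT do: it is pure algebra; the comb supply (K2), the two-variable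
`L`-function (K3), the algebraic functional equation (K4) and the specialisation (S2) are untouched, and the wall
`AdditiveSplitIMCInclusionAtThree` is NOT proved here. BSD is not proved by any of this.

References: Washington, *Introduction to Cyclotomic Fields*, §7.1–7.2, §13.4 [cite: Washington1997, §7.1–§7.2 and §13.4];
Matsumura, *Commutative Ring Theory*, Thm. 20.3 [cite: Matsumura1987, Thm. 20.3].
-/

set_option linter.dupNamespace false

noncomputable section

namespace Summit.BirchSwinnertonDyer.BirchSwinnertonDyer.Theorems.UniversalToricDescentThinComb

open Polynomial

section Main

variable (𝒪 : Type*) [CommRing 𝒪] [IsDomain 𝒪] [IsDiscreteValuationRing 𝒪] (p : ℕ) [hp : Fact p.Prime]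

/-- **The `p`-free part divides `F`.** Let `G₀ ≠ 0` with `p ∤ G₀`, `ρ G₀ ∼ G₀`, `ρ F ∼ F` for a reflection `ρ`,
and `G₀ ∣ p^{t_m} F` modulo `E_m` on levels of unbounded order. Then `G₀ ∣ F`. Prime by prime over the factorial
`Λ₂(𝒪)`: a prime `P ∣ G₀` outside `(p, T₂)` is visible on every level; one inside `(p, T₂) ∩ (p, T₁)` is visible on
all deep levels; one inside `(p, T₂)` but outside `(p, T₁)` is handled through `ρ P ∉ (p, T₂)` and the symmetry of
`G₀` and `F`. [cite: Washington1997, §7.1–§7.2 and §13.4; Matsumura1987, Thm. 20.3] -/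
theorem pfree_dvd_of_levels (hmax : IsLocalRing.maximalIdeal 𝒪 = Ideal.span {(p : 𝒪)})
    {ρ : PowerSeries (PowerSeries 𝒪) ≃+* PowerSeries (PowerSeries 𝒪)} (hρ : IsReflection 𝒪 ρ)
    {G₀ F : PowerSeries (PowerSeries 𝒪)} (hG₀0 : G₀ ≠ 0) (hG₀p : ¬ const 𝒪 (p : 𝒪) ∣ G₀)
    (hρG₀ : Associated (ρ G₀) G₀) (hF : Associated (ρ F) F)
    (hlev : ∀ n : ℕ, ∃ m : ℕ, n ≤ m ∧ ∃ t : ℕ, const 𝒪 ((p : 𝒪) ^ t) * F ∈ Ideal.span {G₀, combElt 𝒪 p m}) :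
    G₀ ∣ F := by
  classical
  obtain ⟨hp0, hpu, hprime, hpprime⟩ := p_ne_zero_of_maximalIdeal_eq 𝒪 p hmax
  haveI := Literature.NumberTheory.IwasawaTheory.uniqueFactorizationMonoid_powerSeries_powerSeries 𝒪
  have hcp : Prime (const 𝒪 (p : 𝒪)) :=
    Literature.NumberTheory.EllipticCurves.prime_C_of_prime (Literature.NumberTheory.EllipticCurves.prime_C_of_prime hpprime)
  -- levels for every divisor of `G₀`
  have hlevD : ∀ D, D ∣ G₀ → ∀ n : ℕ, ∃ m : ℕ, n ≤ m ∧
      ∃ t : ℕ, const 𝒪 ((p : 𝒪) ^ t) * F ∈ Ideal.span {D, combElt 𝒪 p m} := by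
    rintro D ⟨c, rfl⟩ n
    obtain ⟨m, hnm, t, hmem⟩ := hlev n
    obtain ⟨a, b, hab⟩ := Ideal.mem_span_pair.mp hmem
    exact ⟨m, hnm, t, Ideal.mem_span_pair.mpr ⟨a * c, b, by rw [← hab]; ring⟩⟩
  -- facts about `ρ`: it fixes constants and maps `(p, T₁)` onto `(p, T₂)`
  have hρconst : ∀ c : 𝒪, ρ (const 𝒪 c) = const 𝒪 c := hρ.2.2
  have hρsymm_const : ∀ c : 𝒪, ρ.symm (const 𝒪 c) = const 𝒪 c := fun c => by
    rw [RingEquiv.symm_apply_eq, hρconst]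
  have hmap : Ideal.map (ρ : PowerSeries (PowerSeries 𝒪) →+* PowerSeries (PowerSeries 𝒪))
      (Ideal.span {const 𝒪 (p : 𝒪), T₁ 𝒪}) = Ideal.span {const 𝒪 (p : 𝒪), T₂ 𝒪} := by
    rw [Ideal.map_span, Set.image_pair, RingHom.coe_coe, hρconst]
    -- `ρ T₁ = (1 + T₂)⁻¹ − 1 = −T₂ · (1 + T₂)⁻¹`
    set w := Units.mkOfMulEqOne _ _ hρ.1 with hw
    have hw1 : (↑w : PowerSeries (PowerSeries 𝒪)) = 1 + T₂ 𝒪 := by rw [hw, Units.val_mkOfMulEqOne]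
    have hw2 : (↑w⁻¹ : PowerSeries (PowerSeries 𝒪)) = 1 + ρ (T₁ 𝒪) :=
      Units.inv_eq_of_mul_eq_one_right (by rw [hw1]; exact hρ.1)
    have hρT₁ : ρ (T₁ 𝒪) = T₂ 𝒪 * (-↑w⁻¹) := by
      have h3 : ρ (T₁ 𝒪) = ↑w⁻¹ - 1 := by rw [hw2]; ring
      have h5 : (↑w⁻¹ : PowerSeries (PowerSeries 𝒪)) - 1 = ↑w⁻¹ * (1 - ↑w) := by
        rw [mul_sub, mul_one, Units.inv_mul]
      rw [h3, h5, hw1]; ring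
    rw [hρT₁]
    apply le_antisymm <;> rw [Ideal.span_le] <;> intro x hx <;>
      rcases hx with rfl | rfl
    · exact Ideal.subset_span (by simp)
    · exact Ideal.mul_mem_right _ _ (Ideal.subset_span (by simp))
    · exact Ideal.subset_span (by simp)
    · have : T₂ 𝒪 = T₂ 𝒪 * (-↑w⁻¹) * (-↑w) := by
        rw [mul_assoc, neg_mul_neg, Units.inv_mul, mul_one]
      rw [this]
      exact Ideal.mul_mem_right _ _ (Ideal.subset_span (by simp))
  -- prime-by-prime
  refine UniqueFactorizationMonoid.induction_on_coprime (P := fun D => D ∣ G₀ → D ∣ F) G₀ ?_ ?_ ?_ ?_ dvd_rfl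
  · intro h; exact absurd (zero_dvd_iff.mp h) hG₀0
  · intro x hx _; exact hx.dvd
  · intro P k hP hPk
    rcases k with _ | k
    · simp
    have hPp : ¬ P ∣ const 𝒪 (p : 𝒪) := fun h =>
      hG₀p ((hP.irreducible.associated_of_dvd hcp.irreducible h).symm.dvd.trans
        ((dvd_pow_self P (Nat.succ_ne_zero k)).trans hPk))
    have hPc : ¬ const 𝒪 (p : 𝒪) ∣ P := fun h =>
      hPp (hcp.irreducible.associated_of_dvd hP.irreducible h).symm.dvd
    by_cases h2 : P ∈ Ideal.span {const 𝒪 (p : 𝒪), T₂ 𝒪}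
    · by_cases h1 : P ∈ Ideal.span {const 𝒪 (p : 𝒪), T₁ 𝒪}
      · -- `P ∈ (p, T₁) ∩ (p, T₂)`: visible on all deep levels
        obtain ⟨m₀, hm₀⟩ := exists_level_not_shape_of_mem_span_T₁ 𝒪 p hmax h1 hPc
        refine pow_dvd_of_visible_levels 𝒪 p hmax hP hPp (k + 1) F
          (levels_avoiding 𝒪 p hPp fun n => ?_)
        obtain ⟨m, hnm, hmem⟩ := hlevD _ hPk (max n m₀)
        exact ⟨m, le_of_max_le_left hnm, visible_of_not_shape 𝒪 p hmax m (hm₀ m (le_of_max_le_right hnm)),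
          hmem⟩
      · -- `P ∈ (p, T₂)`, `P ∉ (p, T₁)`: reflect
        have hQ : Prime (ρ P) := (MulEquiv.prime_iff ρ).mpr hP
        have hQ2 : ρ P ∉ Ideal.span {const 𝒪 (p : 𝒪), T₂ 𝒪} := by
          intro hmem
          apply h1
          have := Ideal.mem_map_of_mem (ρ.symm : PowerSeries (PowerSeries 𝒪) →+* PowerSeries (PowerSeries 𝒪))
            hmem
          rwa [← hmap, Ideal.map_of_equiv, RingHom.coe_coe, RingEquiv.symm_apply_apply] at this
        have hQp : ¬ ρ P ∣ const 𝒪 (p : 𝒪) := fun h => hPp (by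
          have := map_dvd (ρ.symm : PowerSeries (PowerSeries 𝒪) →+* PowerSeries (PowerSeries 𝒪)) h
          rwa [RingHom.coe_coe, RingEquiv.symm_apply_apply, hρsymm_const] at this)
        have hQk : ρ P ^ (k + 1) ∣ G₀ := by
          rw [← map_pow]; exact (map_dvd ρ hPk).trans hρG₀.dvd
        have hQF : ρ P ^ (k + 1) ∣ F := by
          refine pow_dvd_of_visible_levels 𝒪 p hmax hQ hQp (k + 1) F
            (levels_avoiding 𝒪 p hQp fun n => ?_)
          obtain ⟨m, hnm, hmem⟩ := hlevD _ hQk n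
          exact ⟨m, hnm, visible_of_not_shape 𝒪 p hmax m
            (not_shape_of_not_mem_span_T₂ 𝒪 p m hmax hQ2 hQ.not_unit), hmem⟩
        -- back through `ρ⁻¹`
        have h1' : P ^ (k + 1) ∣ ρ.symm F := by
          have := map_dvd (ρ.symm : PowerSeries (PowerSeries 𝒪) →+* PowerSeries (PowerSeries 𝒪)) hQF
          rwa [RingHom.coe_coe, map_pow, RingEquiv.symm_apply_apply] at this
        obtain ⟨u, hu⟩ := hF
        have hFs : ρ.symm F = F * ρ.symm ↑u := by
          conv_lhs => rw [← hu]
          rw [map_mul, RingEquiv.symm_apply_apply]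
        have hsymmF : ρ.symm F ∣ F := ⟨ρ.symm ↑u⁻¹, by
          rw [hFs, mul_assoc, ← map_mul, Units.mul_inv, map_one, mul_one]⟩
        exact h1'.trans hsymmF
    · -- `P ∉ (p, T₂)`: visible on every level
      refine pow_dvd_of_visible_levels 𝒪 p hmax hP hPp (k + 1) F (levels_avoiding 𝒪 p hPp fun n => ?_)
      obtain ⟨m, hnm, hmem⟩ := hlevD _ hPk n
      exact ⟨m, hnm, visible_of_not_shape 𝒪 p hmax m (not_shape_of_not_mem_span_T₂ 𝒪 p m hmax h2 hP.not_unit),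
        hmem⟩
  · intro x y hxy hx hy hdvd
    exact hxy.mul_dvd (hx (dvd_of_mul_right_dvd hdvd)) (hy (dvd_of_mul_left_dvd hdvd))

/-- If `F` is comb-divisible by `0` (i.e. `E_m ∣ p^{t_m} F` on levels of unbounded order) then `F = 0`.
[cite: Washington1997, §7.1–§7.2] -/
theorem eq_zero_of_thinCombDvdRat_zero (hmax : IsLocalRing.maximalIdeal 𝒪 = Ideal.span {(p : 𝒪)})
    {F : PowerSeries (PowerSeries 𝒪)} (h : ThinCombDvdRat 𝒪 p 0 F) : F = 0 := by
  obtain ⟨hp0, hpu, hprime, hpprime⟩ := p_ne_zero_of_maximalIdeal_eq 𝒪 p hmax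
  ext i : 1
  rw [map_zero]
  by_contra hg
  obtain ⟨m₀, hm₀⟩ := C_pow_dvd_of_mk_mem_span 𝒪 p hmax hg
  obtain ⟨m, hm, t, hmem⟩ := h m₀
  obtain ⟨a, b, hab⟩ := Ideal.mem_span_pair.mp hmem
  rw [mul_zero, zero_add] at hab
  -- coefficient `i`: `[T₁^i]b · E_m = p^t · [T₁^i]F`, so the class of `[T₁^i]F` vanishes in `𝒪_m`
  have hi := congrArg (PowerSeries.coeff i) hab
  rw [combElt, PowerSeries.coeff_mul_C, const, RingHom.comp_apply, PowerSeries.coeff_C_mul] at hi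
  set π := Ideal.Quotient.mk (Ideal.span {combSeries 𝒪 p m}) with hπ
  have hzero : π (PowerSeries.coeff i F) = 0 := by
    apply natCast_p_pow_mul_eq_zero_imp 𝒪 p m hp0 t
    have h1 : (p : LevelRing 𝒪 p m) ^ t = π (PowerSeries.C ((p : 𝒪) ^ t)) := by simp [hπ]
    rw [h1, ← map_mul, ← hi, map_mul, Ideal.Quotient.eq_zero_iff_mem.mpr (Ideal.mem_span_singleton_self _),
      mul_zero]
  -- hence every power of `C p` divides `[T₁^i]F ≠ 0`: impossible
  have hCp : ¬ IsUnit (PowerSeries.C (p : 𝒪)) := fun h => hpu (by simpa using PowerSeries.isUnit_constantCoeff _ h)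
  obtain ⟨μ, g₀, hndvd, hg₀⟩ := WfDvdMonoid.max_power_factor' hg hCp
  have hdvd : PowerSeries.C (p : 𝒪) ^ (μ + 1) ∣ PowerSeries.coeff i F :=
    hm₀ m hm (μ + 1) (by rw [hzero]; exact Ideal.zero_mem _)
  rw [hg₀, pow_succ] at hdvd
  exact hndvd ((mul_dvd_mul_iff_left (pow_ne_zero μ
    (Literature.NumberTheory.EllipticCurves.prime_C_of_prime hpprime).ne_zero)).mp hdvd)

/-- **THIN-COMB + REFLECTION RIGIDITY, rational form (card item K1), PROVED** for every discrete valuation ring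
`𝒪` with maximal ideal `(p)` (e.g. `ℤ_p`, `R₀ = W(𝔽̄_p)`): `ρ`-symmetric `G, F` with `G ∣ p^{t_m} F` on comb levels
of unbounded order satisfy `G ∣ p^a F` in `𝒪⟦T₂⟧⟦T₁⟧`. [cite: Washington1997, §7.1–§7.2 and §13.4; Matsumura1987, Thm. 20.3] -/
theorem combReflectionRigidityRat_of_maximalIdeal_eq (hmax : IsLocalRing.maximalIdeal 𝒪 = Ideal.span {(p : 𝒪)}) :
    CombReflectionRigidityRat 𝒪 p := by
  intro ρ hρ G F hG hF hcomb
  obtain ⟨hp0, hpu, hprime, hpprime⟩ := p_ne_zero_of_maximalIdeal_eq 𝒪 p hmax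
  have hcp : Prime (const 𝒪 (p : 𝒪)) :=
    Literature.NumberTheory.EllipticCurves.prime_C_of_prime (Literature.NumberTheory.EllipticCurves.prime_C_of_prime hpprime)
  by_cases hG0 : G = 0
  · subst hG0
    have := eq_zero_of_thinCombDvdRat_zero 𝒪 p hmax hcomb
    exact ⟨0, by rw [this, mul_zero]⟩
  obtain ⟨n, G₀, hG₀p, rfl⟩ := WfDvdMonoid.max_power_factor' hG0 hcp.not_unit
  have hG₀0 : G₀ ≠ 0 := right_ne_zero_of_mul hG0
  have hρG₀ : Associated (ρ G₀) G₀ := by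
    obtain ⟨u, hu⟩ := hG
    rw [map_mul, map_pow, hρ.2.2, mul_assoc] at hu
    exact ⟨u, mul_left_cancel₀ (pow_ne_zero n hcp.ne_zero) hu⟩
  have hlev : ∀ k : ℕ, ∃ m : ℕ, k ≤ m ∧
      ∃ t : ℕ, const 𝒪 ((p : 𝒪) ^ t) * F ∈ Ideal.span {G₀, combElt 𝒪 p m} := by
    intro k
    obtain ⟨m, hkm, t, hmem⟩ := hcomb k
    obtain ⟨a, b, hab⟩ := Ideal.mem_span_pair.mp hmem
    exact ⟨m, hkm, t, Ideal.mem_span_pair.mpr ⟨a * const 𝒪 (p : 𝒪) ^ n, b, by rw [← hab]; ring⟩⟩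
  obtain ⟨c, hc⟩ := pfree_dvd_of_levels 𝒪 p hmax hρ hG₀0 hG₀p hρG₀ hF hlev
  exact ⟨n, c, by rw [map_pow, hc]; ring⟩

/-- **THIN-COMB + REFLECTION RIGIDITY, integral form (card item K1), PROVED** for every discrete valuation ring `𝒪`
with maximal ideal `(p)`: with integral comb divisibility, `G ∣ F`. [cite: Washington1997, §7.1–§7.2 and §13.4; Matsumura1987, Thm. 20.3] -/
theorem combReflectionRigidityInt_of_maximalIdeal_eq (hmax : IsLocalRing.maximalIdeal 𝒪 = Ideal.span {(p : 𝒪)}) :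
    CombReflectionRigidityInt 𝒪 p := by
  classical
  intro ρ hρ G F hG hF hcombI
  obtain ⟨hp0, hpu, hprime, hpprime⟩ := p_ne_zero_of_maximalIdeal_eq 𝒪 p hmax
  haveI := Literature.NumberTheory.IwasawaTheory.uniqueFactorizationMonoid_powerSeries_powerSeries 𝒪
  have hCp : Prime (PowerSeries.C (p : 𝒪)) := Literature.NumberTheory.EllipticCurves.prime_C_of_prime hpprime
  have hcp : Prime (const 𝒪 (p : 𝒪)) := Literature.NumberTheory.EllipticCurves.prime_C_of_prime hCp
  have hcomb : ThinCombDvdRat 𝒪 p G F := fun k => by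
    obtain ⟨m, hkm, hmem⟩ := hcombI k
    exact ⟨m, hkm, 0, by rwa [pow_zero, map_one, one_mul]⟩
  by_cases hG0 : G = 0
  · subst hG0
    rw [eq_zero_of_thinCombDvdRat_zero 𝒪 p hmax hcomb]
  obtain ⟨n, G₀, hG₀p, rfl⟩ := WfDvdMonoid.max_power_factor' hG0 hcp.not_unit
  have hG₀0 : G₀ ≠ 0 := right_ne_zero_of_mul hG0
  have hρG₀ : Associated (ρ G₀) G₀ := by
    obtain ⟨u, hu⟩ := hG
    rw [map_mul, map_pow, hρ.2.2, mul_assoc] at hu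
    exact ⟨u, mul_left_cancel₀ (pow_ne_zero n hcp.ne_zero) hu⟩
  have hlev : ∀ k : ℕ, ∃ m : ℕ, k ≤ m ∧
      ∃ t : ℕ, const 𝒪 ((p : 𝒪) ^ t) * F ∈ Ideal.span {G₀, combElt 𝒪 p m} := by
    intro k
    obtain ⟨m, hkm, t, hmem⟩ := hcomb k
    obtain ⟨a, b, hab⟩ := Ideal.mem_span_pair.mp hmem
    exact ⟨m, hkm, t, Ideal.mem_span_pair.mpr ⟨a * const 𝒪 (p : 𝒪) ^ n, b, by rw [← hab]; ring⟩⟩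
  have h1 : G₀ ∣ F := pfree_dvd_of_levels 𝒪 p hmax hρ hG₀0 hG₀p hρG₀ hF hlev
  -- the power of `p`: `(C p)^n` divides every `T₁`-coefficient of `F`
  have h2 : const 𝒪 (p : 𝒪) ^ n ∣ F := by
    have hcoef : ∀ i, PowerSeries.C (p : 𝒪) ^ n ∣ PowerSeries.coeff i F := by
      intro i
      by_cases hg : PowerSeries.coeff i F = 0
      · rw [hg]; exact dvd_zero _
      obtain ⟨m₀, hm₀⟩ := C_pow_dvd_of_mk_mem_span 𝒪 p hmax hg
      obtain ⟨m, hm, hmem⟩ := hcombI m₀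
      obtain ⟨a, b, hab⟩ := Ideal.mem_span_pair.mp hmem
      refine hm₀ m hm n ?_
      have hab' : PowerSeries.C (PowerSeries.C (p : 𝒪)) ^ n * (a * G₀) + b * combElt 𝒪 p m = F := by
        rw [← hab]; simp only [const, RingHom.comp_apply]; ring
      have hi := congrArg (PowerSeries.coeff i) hab'
      rw [map_add, combElt, PowerSeries.coeff_mul_C, ← map_pow, ← map_pow, PowerSeries.coeff_C_mul,
        map_pow] at hi
      rw [← hi, map_add, map_mul, map_mul _ (PowerSeries.coeff i b),
        Ideal.Quotient.eq_zero_iff_mem.mpr (Ideal.mem_span_singleton_self (combSeries 𝒪 p m)), mul_zero,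
        add_zero]
      refine Ideal.mul_mem_right _ _ ?_
      have : Ideal.Quotient.mk (Ideal.span {combSeries 𝒪 p m}) (PowerSeries.C (p : 𝒪) ^ n) =
          (p : LevelRing 𝒪 p m) ^ n := by simp
      rw [this]; exact Ideal.mem_span_singleton_self _
    choose q hq using hcoef
    refine ⟨PowerSeries.mk q, ?_⟩
    ext i : 1
    rw [hq i, show const 𝒪 (p : 𝒪) ^ n = PowerSeries.C (PowerSeries.C (p : 𝒪) ^ n) by
      simp only [const, RingHom.comp_apply, map_pow], PowerSeries.coeff_C_mul, PowerSeries.coeff_mk]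
  -- `p^n` and the `p`-free part are coprime
  have hrel : IsRelPrime (const 𝒪 (p : 𝒪) ^ n) G₀ :=
    ((hcp.irreducible.isRelPrime_iff_not_dvd).mpr hG₀p).pow_left
  exact hrel.mul_dvd h2 h1

/-- `ℤ_p` instance of the rigidity lemma (rational form). [cite: Washington1997, §7.1–§7.2] -/
theorem combReflectionRigidityRat_padicInt : CombReflectionRigidityRat ℤ_[p] p :=
  combReflectionRigidityRat_of_maximalIdeal_eq ℤ_[p] p PadicInt.maximalIdeal_eq_span_p

/-- `ℤ_p` instance of the rigidity lemma (integral form). [cite: Washington1997, §7.1–§7.2] -/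
theorem combReflectionRigidityInt_padicInt : CombReflectionRigidityInt ℤ_[p] p :=
  combReflectionRigidityInt_of_maximalIdeal_eq ℤ_[p] p PadicInt.maximalIdeal_eq_span_p


/-- `R₀ = unrIntegers p` instance of the rigidity lemma (rational form) — the coefficient ring of the wall's
receptacle `UnrSeries p = R₀⟦T⟧`. [cite: Washington1997, §7.1–§7.2] -/
theorem combReflectionRigidityRat_unrIntegers :
    CombReflectionRigidityRat (Literature.NumberTheory.EllipticCurves.unrIntegers p) p := by
  haveI := Summit.BirchSwinnertonDyer.Rank1Residual.X2.HidaLimitAlgebra.isDiscreteValuationRing_unrIntegers (p := p)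
  exact combReflectionRigidityRat_of_maximalIdeal_eq _ p
    ((IsDiscreteValuationRing.irreducible_iff_uniformizer _).mp
      Summit.BirchSwinnertonDyer.Rank1Residual.X2.HidaLimitAlgebra.irreducible_natCast_p)

/-- `R₀ = unrIntegers p` instance of the rigidity lemma (integral form). [cite: Washington1997, §7.1–§7.2] -/
theorem combReflectionRigidityInt_unrIntegers :
    CombReflectionRigidityInt (Literature.NumberTheory.EllipticCurves.unrIntegers p) p := by
  haveI := Summit.BirchSwinnertonDyer.Rank1Residual.X2.HidaLimitAlgebra.isDiscreteValuationRing_unrIntegers (p := p)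
  exact combReflectionRigidityInt_of_maximalIdeal_eq _ p
    ((IsDiscreteValuationRing.irreducible_iff_uniformizer _).mp
      Summit.BirchSwinnertonDyer.Rank1Residual.X2.HidaLimitAlgebra.irreducible_natCast_p)

end Main

end Summit.BirchSwinnertonDyer.BirchSwinnertonDyer.Theorems.UniversalToricDescentThinComb

end
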